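/-
Copyright (c) 2026. All rights reserved.
Released under Apache 2.0 license as described in the file LICENSE.
Authors: abc-iut cell, prover seat abc-iut-f-066 (gen 8; row «F3081 BUILD r1» B3, abc-iut-L4-lead m211/m212), over this seat's
B1/B2a/B2b/B2c (`LogFrobeniusRealisesRelLiftsTS{,Over,Push,Union}.lean`), abc-iut-f-102's THEOREM B
(`LogFrobeniusRealisesSufficiency.lean`), abc-iut-L4-t3's add-on laws (`LogFrobeniusLamOverLink.lean`) — every input consumed
BY NAME; nothing of those files is restated.
-/
import Literature.AnabelianGeometry.AbsoluteAnabelian.LogFrobeniusRealisesRelLiftsTSUnion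
import HarnessLib

/-!
# [AbsTopIII] Cor 5.5 (iii), last sentence on `D•⊢` (F-3081 `Cor55ObservablesCompatible`) — SUFFICIENCY

S. Mochizuki, *Topics in absolute anabelian geometry III: global reconstruction algorithms* [MochizukiAbsTopIII2015];
locators `p.N` = pages of the author's manuscript (`paper:url-5493eb38cbb7`), read on the page: Cor 5.5 (iii) p. 131 l. 30–40
("the families of homotopies that constitute `S_log` and `S_log⊞` are compatible with one another as well as with the families of
homotopies that constitute the core and telecore structures of (i), (ii)"), Cor 5.5 (i) p. 130 (the cores `ℰ•`, `An•[𝒳]`, `ℰ•`),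
Def 3.5 (ii)/(iii) p. 75, Rmk 3.5.1 p. 78.

PROOF-ONLY file (no definition, no instance, no named-fact hypothesis).  abc-iut-L4-t3 typed the last sentence of Cor 5.5 (iii) on
`D•⊢` as the assumption `Cor55ObservablesCompatible L T` (FACT-LIST F-3081): ONE family `K` on `D•⊢` realising the three cores and
the `S_log⊞_v` (`RealisesCor55Families K`) AND containing at every `v` an observable `S_log_v` (`IsLogObservableTS`, `CompatibleIn`).
★ `cor55ObservablesCompatible_of`: it HOLDS for a setting over a nonempty `V(F_mod)` whose `ι⊞`-squares commute
(`IotaSquaresCommute`), whose `ι⊞` lie over `Th•[Z]` (abc-iut-L4-t3's `IotaOver`) with linked space-link / post-log over-structures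
(`LamOverLink`), and which carries `TS`-observable families `Hts v` (`IsLogObservableTS T v (Hts v)`, reflexive on the paths into
`𝒩_v`) whose homotopies lie over `Th•[Z]` (abc-iut-w5-d144's `(logTSOverE v).IsOver`).  The family is `K := relFamily
realisesRelLiftsTS` (B2c): abc-iut-f-102's THEOREM-B family `K₁` is a sub-family (so the cores — each relating ALL pairs — and the
`S_log⊞_v` are realised: `isCoreOnIn_of_forall_E`, abc-iut-L4-t15's `reach_e5/an/e7`, THEOREM B's `S_log⊞` clause transported along
`relFamily_realises_sub`), and every boundary pair of `S_log_v` is a boundary pair of `K` with the same homotopy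
(`relFamily_ts_mem`).  All binders are discharged at the genuine carriers in the next file (B4).
HONEST LABELS: an ASSUMPTION-DISCHARGING theorem over OUR typed interface (the frozen `LogFrobeniusSetting`); the typed statement is
abc-iut-L4-t3's reading of the printed sentence (compatibility with the telecore family of (ii) is the separate row F-3757);
refereed pre-IUT material; nothing here bears on [IUTchIII] Cor. 3.12; no side taken; typed ≠ proved for print's theaters.
-/

set_option autoImplicit false

universe u

open CategoryTheory Quiver

namespace Literature.AnabelianGeometry.AbsoluteAnabelian

namespace LogFrobeniusSetting

open DiagramOfCategories

variable {Vmod : Type u} {isArc : Vmod → Bool} (L : LogFrobeniusSetting Vmod isArc)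

section Of

variable (hsq : ∀ v, L.IotaSquaresCommute v) (T : L.TSHomotopies) (Hts : ∀ v : Vmod, (L.logDiagramTS v).HomotopyFamily)
  (hobs : ∀ v, L.IsLogObservableTS T v (Hts v))
  (hrefl : ∀ (v : Vmod) {a' : (logShapeTS (isArc := isArc) v).Vertex} (p : Path a' (logShapeTS (isArc := isArc) v).obs),
    (Hts v).E p p)
  (hover : ∀ (v : Vmod) {a' : (logShapeTS (isArc := isArc) v).Vertex}
    {p q : Path a' (logShapeTS (isArc := isArc) v).obs} (h : (Hts v).E p q), (L.logTSOverE v).IsOver p q ((Hts v).η h))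

/-- «`ι⊞` over `Th•[Z]`» along a PRE-log edge, in the component form THEOREM B consumes, for abc-iut-L4-t3's over-datum `lamOver`
(abc-iut-L4-t3's `IotaOver.toE_map_iota_heq_of_preLog`). [cite: MochizukiAbsTopIII2015, Def 5.4 (vii) p. 128] -/
theorem hpre_of_iotaOver (hι : L.IotaOver) (v : Vmod) (ν₁ ν₂ : LogVertex (isArc v)) (ε : LogEdge (isArc v) ν₁ ν₂) (h₁ : ν₁.isPostLog = false)
    (h₂ : ν₂.isPostLog = false) (X₀ : L.X) :
    HEq ((L.toE v).map ((L.forget v).map ((L.iota v ε).app X₀)))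
      ((L.lamOverData v ν₁ h₁).hom.app X₀ ≫ (L.lamOverData v ν₂ h₂).inv.app X₀) :=
  hι.toE_map_iota_heq_of_preLog v ε h₁ X₀

/-- «`ι⊞` over `Th•[Z]`» along a POST-log edge through the space-link, in THEOREM B's component form, for `lamOver` / `logOver`
(abc-iut-L4-t3's `IotaOver.toE_map_iota_heq_spaceLink`, using `LamOverLink`). [cite: MochizukiAbsTopIII2015, Cor 5.5 p. 130] -/
theorem hpost_of_iotaOver_lamOverLink (hι : L.IotaOver) (hΛ : L.LamOverLink) (v : Vmod) (ν₁ ν₂ : LogVertex (isArc v)) (ε : LogEdge (isArc v) ν₁ ν₂)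
    (h₁ : ν₁.isPostLog = true) (h₂ : ν₂.isPostLog = false) (hsl : (LogVertex.spaceLink (isArc v)).isPostLog = false) (X₀ : L.X) :
    HEq ((L.toE v).map ((L.forget v).map ((L.iota v ε).app X₀)))
      ((L.lamOverData v _ hsl).hom.app (L.log.obj X₀) ≫ L.logOver.hom.app X₀ ≫ (L.lamOverData v ν₂ h₂).inv.app X₀) :=
  hι.toE_map_iota_heq_spaceLink hΛ v ε h₁ X₀

/-- **THE family of Cor 5.5 (iii), last sentence, on `D•⊢`**: the family generated by B2c's `realisesRelLiftsTS` (pivots the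
three cores, the `𝒩⊞_v`, the `𝒩_v`). [cite: MochizukiAbsTopIII2015, Cor 5.5 (iii) p. 131] -/
theorem realisesCor55Families_relFamily_realisesRelLiftsTS [Nonempty Vmod] (hι : L.IotaOver) (hΛ : L.LamOverLink) :
    L.RealisesCor55Families (relFamily (L.realisesRelLiftsTS hsq (L.hpre_of_iotaOver hι) (L.hpost_of_iotaOver_lamOverLink hι hΛ)
      Hts T hobs hrefl hover)) := by
  -- every pair into a core vertex is related there (a core relates ALL pairs), hence a boundary pair of the union's family
  have hcore : ∀ (w : DVertex Vmod isArc) (hw : IsPivot w) (hwc : IsCoreVertex w) {a : DVertex Vmod isArc} (p q : Path a w),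
      (relFamily (L.realisesRelLiftsTS hsq (L.hpre_of_iotaOver hι) (L.hpost_of_iotaOver_lamOverLink hι hΛ)
        Hts T hobs hrefl hover)).E p q := by
    intro w hw hwc a p q
    refine relE_of_rel _ (Or.inl hw) (Or.inl ⟨hw, ?_⟩)
    cases w with
    | e5 => trivial
    | an => trivial
    | e7 => trivial
    | _ => exact hwc.elim
  refine ⟨L.isCoreOnIn_of_forall_E _ _ _ (fun p q => hcore .e5 trivial trivial p q) reach_e5,
    L.isCoreOnIn_of_forall_E _ _ _ (fun p q => hcore .an trivial trivial p q) reach_an,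
    L.isCoreOnIn_of_forall_E _ _ _ (fun p q => hcore .e7 trivial trivial p q) reach_e7, fun v => ?_⟩
  -- the `S_log⊞_v` of THEOREM B, transported along the containment of THEOREM B's family in the union's
  obtain ⟨H, hH, hc⟩ := L.exists_isLogObservablePlus_realisingFamily L.lamOverData L.logOver hsq (L.hpre_of_iotaOver hι)
    (L.hpost_of_iotaOver_lamOverLink hι hΛ) v
  refine ⟨H, hH, fun a b p q h => ?_⟩
  obtain ⟨h₁, e₁⟩ := hc p q h
  obtain ⟨h₂, e₂⟩ := L.relFamily_realises_sub hsq (L.hpre_of_iotaOver hι) (L.hpost_of_iotaOver_lamOverLink hι hΛ) Hts T hobs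
    hrefl hover _ _ h₁
  exact ⟨h₂, e₁.trans (heq_of_eq e₂)⟩

include hsq Hts hobs hrefl hover in
/-- ★ **[AbsTopIII] Cor 5.5 (iii), last sentence, on `D•⊢` — SUFFICIENCY for F-3081** (abc-iut-L4-t3's `Cor55ObservablesCompatible`):
for a setting over a nonempty `V(F_mod)` with commuting `ι⊞`-squares, `ι⊞` over `Th•[Z]` (`IotaOver`), linked over-structures
(`LamOverLink`), and `TS`-observables `S_log_v = Hts v` (reflexive, with homotopies over `Th•[Z]`), ONE family of homotopies on
`D•⊢` realises the cores `ℰ•`, `An•[𝒳]`, `ℰ•` of (i) and the `S_log⊞_v` AND contains every `S_log_v`: "the families of homotopies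
that constitute `S_log` and `S_log⊞` are compatible with one another as well as with the families of homotopies that constitute
the core … structures of (i)". [cite: MochizukiAbsTopIII2015, Cor 5.5 (iii) p. 131] -/
theorem cor55ObservablesCompatible_of [Nonempty Vmod] (hι : L.IotaOver) (hΛ : L.LamOverLink) : L.Cor55ObservablesCompatible T :=
  ⟨relFamily (L.realisesRelLiftsTS hsq (L.hpre_of_iotaOver hι) (L.hpost_of_iotaOver_lamOverLink hι hΛ) Hts T hobs hrefl hover),
    L.realisesCor55Families_relFamily_realisesRelLiftsTS hsq T Hts hobs hrefl hover hι hΛ,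
    fun v => ⟨Hts v, hobs v, fun a b p q h => by
      obtain rfl := (hobs v).1 h
      exact L.relFamily_ts_mem hsq (L.hpre_of_iotaOver hι) (L.hpost_of_iotaOver_lamOverLink hι hΛ) Hts T hobs hrefl hover v h⟩⟩

end Of

end LogFrobeniusSetting

end Literature.AnabelianGeometry.AbsoluteAnabelian
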